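import Summits.PneNP.PneNP.Theorems.MonotoneSuffices.Negative.BlockParityLaws
import Literature.Computability.Complexity.RossmanMonotoneCliqueThm2Proofs
import Mathlib.Analysis.SpecificLimits.Normed

/-!
# `MonotoneSuffices` (stmt-PneNP-18026): the product noise is load-bearing — "Tardos on the OR-channel"

Negative-side lemma for the crux `Summit.PneNP.PneNP.Theses.KarlinRubin.MonotoneSuffices` (route
PneNP/KarlinRubin, X₁ "computational Karlin–Rubin": on the pair (`G(n,1/2)`, `G(n,1/2) ∪` planted
`⌈n^{1/2-δ}⌉`-clique) every strongly detecting `B₂` family of size `s` has a strongly detecting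
`{∧₂,∨₂,0,1}` companion of size `(s+n)^a`). The route's rationale for X₁ is that the planted pair is
STOCHASTICALLY ORDERED — positives are negatives with extra ones OR-ed in ("OR-channel") — "the bet is that
stochastic order removes the Tardos phenomenon" (route file, Barriers section).

This file proves, sorry-free, that stochastic order / the OR-channel shape ALONE does not: the crux with
its specific noise `G(n,1/2)` (a PRODUCT measure) and its specific pattern (a clique) generalised to
"noise `X u` OR independent planted pattern `P s`, `u`, `s` uniform" is FALSE, and fails already at the
level of Boolean FUNCTIONS (no circuit-size lower bound is involved):

* `monotoneSuffices_false_without_productNoise` — the OR-channel form of the crux (same quantifier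
  shape `∃ a ∀ s, (∃ B₂ family of size ≤ s, error sum → 0) → (∃ {∧,∨,0,1} family of size
  ≤ (s + N)^a, error sum → 0)`, over an arbitrary coordinate set with `N` coordinates) is false.
* The witness ("block-parity noise"): level `n` has `n` blocks; a block is `64^n` independent uniform
  bits followed by ONE parity bit (the XOR of the block); the planted pattern sets one uniformly random
  non-parity position of every block to `1`.
  - `orChannel_general_detects`: the `B₂` circuits "some block has odd parity" (XOR chains, size
    `≤ 3N`, `exists_detect_circuit`) accept the noise with probability `0` (`noiseLaw_detect`) and reject
    the planted input with probability exactly `2^{-n}` (`plantedLaw_detect_false`: the planting is missed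
    iff all `n` planted positions were already `1`).
  - `orChannel_monotone_blind`: for EVERY sequence of monotone Boolean functions `fₙ` (any size) the
    error sum does not tend to `0` — in fact `Pr_noise[fₙ = 1] + Pr_planted[fₙ = 0] ≥ 1 - 3n/2^n`.
* The finite inequality behind it (`plantedLaw_le_noiseLaw_add`, `card_bad_bound`): for `a` blocks of
  `b` bits and every monotone `f`,  `Pr_planted[f = 1] - Pr_noise[f = 1] ≤ 4^a (⌊√N⌋ + 1) / b`,
  `N = a(b+1)`. Proof: plant the blocks one at a time; the increase of `Pr[f = 1]` at step `j` is the
  probability of standing at the LOWER endpoint of a boundary edge of the up-set `{f = 1}` in the (uniformly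
  random) planted direction; the law of the partially planted input has density `≤ 2^j · 2^a / 2^N`
  w.r.t. counting measure (`card_fiber_le`, the parity bits cost the factor `2^a`), so the total increase
  is at most `2^a · 2^a · (edge boundary of an up-set) / (b · 2^N)` (`card_bad_mul_le`, path counting over
  first-entrance times `stepSet`), and the edge boundary of ANY up-set of the `N`-cube is `≤ 2^N √N`
  (`bdry_sq_le` — total influence of a monotone function is at most `√N`, proved here by
  `bdry F = ∑_{x∈F} (2|x| - N)` (`bdry_eq_sum`) and Cauchy–Schwarz against the second moment
  `∑_x (2|x|-N)² = N 2^N` (`sum_sq_weight`)). With `b = 64^a` the bound is `≤ 3a/2^a → 0`.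

Reading for the crux. What the planted-clique pair has and block-parity noise lacks is not stochastic
order but a MONOTONE LIKELIHOOD RATIO: for any pattern planted into a PRODUCT measure the likelihood ratio
`E_P[2^{|P|}·1[P ⊆ x]]` is a nonnegative combination of monotone conjunctions, so the Neyman–Pearson tests
are monotone and "monotone FUNCTIONS suffice" holds trivially; the crux is then a pure circuit-SIZE
question (bracketed in the tree by `karlinRubin_monotoneSuffices_of_quasipolyHard` and
`karlinRubin_noPolyDetector_of_monotoneSuffices_of_monotoneBlind`). Any proof of X₁ must therefore use the
product structure of `G(n,1/2)` (equivalently the monotone likelihood ratio), not merely the OR-channel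
shape of the pair; and a "neighbouring OR-channel problem" in the sense of the route's kill criteria must
keep product noise to be informative.

File layout: `CubeBoundary.lean` (edge boundary `≤ 2^N √N`), `BlockParity.lean` (noise,
planting, path counting), `BlockParityDetector.lean` (the parity test and its circuit),
`BlockParityLaws.lean` (the two laws, finite blindness), this file (asymptotic family, refutation).
All statements are over the tree's `Literature.Computability.Complexity.Circuit` (`IsOver`, `B2`,
`monotoneBasis01`, `size`, `eval`) and Mathlib's `PMF.uniformOfFintype` / `PMF.toOuterMeasure`, exactly
as in the crux. Refuter seat refuter-cdisprove-stmt-PneNP-18026-0 (cdisprove, cycle 1), 2026-08-17.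

References (background only; everything here is proved): É. Tardos, Combinatorica 8 (1988) 141–142
(the worst-case gap) [Tardos1988]; R. O'Donnell, *Analysis of Boolean Functions* (2014), §2.3 (total
influence of monotone functions is `O(√n)`; majority is extremal) [ODonnell2014].
-/

set_option linter.dupNamespace false -- `Summit.PneNP.PneNP.…`: summit = sub-problem name (D-0017 single-conjunct layout)

namespace Summit.PneNP.PneNP.Theorems.MonotoneSuffices.Negative

open Finset Function

section Family

open scoped ENNReal
open Filter Topology Literature.Computability.Complexity

/-- Positions inside a block at level `n`: `64^n` of them. [folklore] -/
abbrev Pos (n : ℕ) : Type := Fin (64 ^ n)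

/-- The additive blindness error at level `n` (numerator): `4^n (⌊√N_n⌋ + 1)`. [folklore] -/
def epsNat (n : ℕ) : ℕ := 4 ^ n * (Nat.sqrt (Fintype.card (Coord n (Pos n))) + 1)

/-- The blindness error as a real number: `4^n (⌊√N_n⌋ + 1) / 64^n`. [folklore] -/
noncomputable def epsR (n : ℕ) : ℝ := (epsNat n : ℝ) / ((64 ^ n : ℕ) : ℝ)

/-- `N_n = n (64^n + 1)` coordinates at level `n`. [folklore] -/
theorem card_Coord_Pos (n : ℕ) : Fintype.card (Coord n (Pos n)) = n * (64 ^ n + 1) := by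
  rw [card_Coord, Fintype.card_fin]

/-- `4^n (⌊√N_n⌋ + 1) · 2^n ≤ 3 n · 64^n` for `n ≥ 1`. [folklore] -/
theorem epsNat_mul_le (n : ℕ) (hn : 1 ≤ n) : epsNat n * 2 ^ n ≤ 3 * n * 64 ^ n := by
  have h64 : 1 ≤ 64 ^ n := Nat.one_le_pow _ _ (by norm_num)
  have h8 : (8 : ℕ) ^ n * 8 ^ n = 64 ^ n := by rw [← mul_pow]; norm_num
  have hsqrt : Nat.sqrt (Fintype.card (Coord n (Pos n))) ≤ 2 * n * 8 ^ n := by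
    rw [card_Coord_Pos]
    have hle : n * (64 ^ n + 1) ≤ (2 * n * 8 ^ n) ^ 2 := by
      have : (2 * n * 8 ^ n) ^ 2 = 4 * (n * n) * 64 ^ n := by rw [← h8]; ring
      rw [this]
      nlinarith
    calc Nat.sqrt (n * (64 ^ n + 1)) ≤ Nat.sqrt ((2 * n * 8 ^ n) ^ 2) := Nat.sqrt_le_sqrt hle
      _ = 2 * n * 8 ^ n := Nat.sqrt_eq' _
  have h1 : Nat.sqrt (Fintype.card (Coord n (Pos n))) + 1 ≤ 3 * n * 8 ^ n := by
    have : 1 ≤ n * 8 ^ n := Nat.one_le_iff_ne_zero.2 (Nat.mul_ne_zero (by omega) (by positivity))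
    nlinarith
  have h2 : (4 : ℕ) ^ n * 8 ^ n * 2 ^ n = 64 ^ n := by rw [← mul_pow, ← mul_pow]; norm_num
  calc epsNat n * 2 ^ n = 4 ^ n * (Nat.sqrt (Fintype.card (Coord n (Pos n))) + 1) * 2 ^ n := rfl
    _ ≤ 4 ^ n * (3 * n * 8 ^ n) * 2 ^ n := by gcongr
    _ = 3 * n * (4 ^ n * 8 ^ n * 2 ^ n) := by ring
    _ = 3 * n * 64 ^ n := by rw [h2]

/-- The error term is nonnegative. [folklore] -/
theorem epsR_nonneg (n : ℕ) : 0 ≤ epsR n := by unfold epsR; positivity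

/-- `epsR n ≤ 3n/2^n` for `n ≥ 1`. [folklore] -/
theorem epsR_le (n : ℕ) (hn : 1 ≤ n) : epsR n ≤ 3 * (n : ℝ) / 2 ^ n := by
  unfold epsR
  have h := epsNat_mul_le n hn
  have h64 : (0 : ℝ) < ((64 ^ n : ℕ) : ℝ) := by positivity
  have h2 : (0 : ℝ) < (2 : ℝ) ^ n := by positivity
  rw [div_le_div_iff₀ h64 h2]
  have : ((epsNat n * 2 ^ n : ℕ) : ℝ) ≤ ((3 * n * 64 ^ n : ℕ) : ℝ) := by exact_mod_cast h
  push_cast at this ⊢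
  linarith

/-- The blindness error tends to `0`. [folklore] -/
theorem tendsto_epsR : Tendsto epsR atTop (𝓝 0) := by
  have hmaj : Tendsto (fun n : ℕ => 3 * ((n : ℝ) ^ 1 / 2 ^ n)) atTop (𝓝 0) := by
    simpa using (tendsto_pow_const_div_const_pow_of_one_lt 1 (one_lt_two : (1 : ℝ) < 2)).const_mul 3
  refine squeeze_zero' (Eventually.of_forall epsR_nonneg) ?_ hmaj
  filter_upwards [eventually_ge_atTop 1] with n hn
  calc epsR n ≤ 3 * (n : ℝ) / 2 ^ n := epsR_le n hn
    _ = 3 * ((n : ℝ) ^ 1 / 2 ^ n) := by ring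

/-- The `ℝ≥0∞` error term of `one_le_errSum_add` at level `n` is `ofReal (epsR n)`. [folklore] -/
theorem eps_cast (n : ℕ) :
    ((4 ^ n * (Nat.sqrt (Fintype.card (Coord n (Pos n))) + 1) : ℕ) : ℝ≥0∞) /
        Fintype.card (Pos n) = ENNReal.ofReal (epsR n) := by
  rw [epsR, epsNat, Fintype.card_fin, ENNReal.ofReal_div_of_pos (by positivity),
    ENNReal.ofReal_natCast, ENNReal.ofReal_natCast]

/-- **OR-channel Tardos phenomenon, monotone side (function level).** For the block-parity
noise with one planted `1` per block (`n` blocks of `64^n` bits), NO sequence of monotone Boolean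
functions — of any circuit size — has type-I + type-II error tending to `0`; in fact the error
sum tends to `1`. [folklore] -/
theorem orChannel_monotone_blind (f : (n : ℕ) → (Coord n (Pos n) → Bool) → Bool)
    (hf : ∀ᶠ n in atTop, Monotone (f n)) :
    ¬ Tendsto (fun n => (noiseLaw n (Pos n)).toOuterMeasure {x | f n x = true} +
        (plantedLaw n (Pos n)).toOuterMeasure {x | f n x = false}) atTop (𝓝 0) := by
  intro hT
  have hev : ∀ᶠ n in atTop, (1 : ℝ≥0∞) ≤
      ((noiseLaw n (Pos n)).toOuterMeasure {x | f n x = true} +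
        (plantedLaw n (Pos n)).toOuterMeasure {x | f n x = false}) + ENNReal.ofReal (epsR n) := by
    filter_upwards [hf] with n hn
    rw [← eps_cast]
    exact one_le_errSum_add (f n) hn
  have hsum : Tendsto (fun n => ((noiseLaw n (Pos n)).toOuterMeasure {x | f n x = true} +
      (plantedLaw n (Pos n)).toOuterMeasure {x | f n x = false}) + ENNReal.ofReal (epsR n))
      atTop (𝓝 0) := by
    have h2 : Tendsto (fun n => ENNReal.ofReal (epsR n)) atTop (𝓝 0) := by
      rw [← ENNReal.ofReal_zero]
      exact ENNReal.tendsto_ofReal tendsto_epsR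
    simpa using hT.add h2
  obtain ⟨n, hn1, hn2⟩ := (hev.and (hsum.eventually (gt_mem_nhds zero_lt_one))).exists
  exact absurd hn1 (not_le.2 hn2)

/-- The general detector family (junk, a constant, at `n = 0`). [folklore] -/
noncomputable def detectCircuit (n : ℕ) : Circuit (Coord n (Pos n)) :=
  if h : 0 < n then (exists_detect_circuit (β := Pos n) h).choose else Circuit.const _ false

/-- Specification of the detector family at `n ≥ 1`. [folklore] -/
theorem detectCircuit_spec (n : ℕ) (hn : 0 < n) :
    (detectCircuit n).IsOver B2 ∧ (detectCircuit n).size ≤ 3 * Fintype.card (Coord n (Pos n)) ∧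
      ∀ x, (detectCircuit n).eval x = detect x := by
  rw [detectCircuit, dif_pos hn]
  exact (exists_detect_circuit (β := Pos n) hn).choose_spec

/-- **OR-channel Tardos phenomenon, general side.** The linear-size `B₂` family of block-parity
detectors has type-I error `0` and type-II error `2^{-n} → 0`. [folklore] -/
theorem orChannel_general_detects :
    (∀ᶠ n in atTop, (detectCircuit n).IsOver B2 ∧
        (detectCircuit n).size ≤ 3 * Fintype.card (Coord n (Pos n))) ∧
    Tendsto (fun n => (noiseLaw n (Pos n)).toOuterMeasure {x | (detectCircuit n).eval x = true} +
        (plantedLaw n (Pos n)).toOuterMeasure {x | (detectCircuit n).eval x = false})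
      atTop (𝓝 0) := by
  refine ⟨?_, ?_⟩
  · filter_upwards [eventually_gt_atTop 0] with n hn
    exact ⟨(detectCircuit_spec n hn).1, (detectCircuit_spec n hn).2.1⟩
  · have hev : ∀ᶠ n in atTop,
        (noiseLaw n (Pos n)).toOuterMeasure {x | (detectCircuit n).eval x = true} +
          (plantedLaw n (Pos n)).toOuterMeasure {x | (detectCircuit n).eval x = false} =
        ((2 : ℝ≥0∞)⁻¹) ^ n := by
      filter_upwards [eventually_gt_atTop 0] with n hn
      have hev := (detectCircuit_spec n hn).2.2
      have h1 : {x : Coord n (Pos n) → Bool | (detectCircuit n).eval x = true} = {x | detect x = true} := by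
        ext x; rw [Set.mem_setOf_eq, Set.mem_setOf_eq, hev x]
      have h2 : {x : Coord n (Pos n) → Bool | (detectCircuit n).eval x = false} = {x | detect x = false} := by
        ext x; rw [Set.mem_setOf_eq, Set.mem_setOf_eq, hev x]
      rw [h1, h2, noiseLaw_detect, plantedLaw_detect_false, zero_add, ENNReal.inv_pow]
    refine Tendsto.congr' (EventuallyEq.symm hev) ?_
    exact ENNReal.tendsto_pow_atTop_nhds_zero_of_lt_one (by norm_num)

/-- **`MonotoneSuffices` is false without the product noise — the OR-channel form of the crux is
FALSE ("Tardos on the OR-channel").** The negated statement is the crux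
`Summit.PneNP.PneNP.Theses.KarlinRubin.MonotoneSuffices` with its distribution pair generalised from
(`G(n,1/2)`, `G(n,1/2) ∨` planted clique) to an ARBITRARY "noise ∨ independent planted pattern" pair:
a coordinate set `ι n`, finite uniform sample spaces `U n` (noise seed) and `S n` (pattern seed), noise
`X n u` and pattern `P n s`; negatives are `X u`, positives `X u ∨ P s` (pointwise above the negatives, so
the pair is stochastically ordered exactly as the planted-clique pair is); same quantifier shape
`∃ a ∀ s`, same bases, same error functional, size slack `+ |ι n|` (more generous than the crux's `+ n`).
Witness: block-parity noise (`orChannel_general_detects`, `orChannel_monotone_blind`). [folklore] -/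
theorem monotoneSuffices_false_without_productNoise :
    ¬ ∀ (ι : ℕ → Type) [∀ n, Fintype (ι n)] (U : ℕ → Type) [∀ n, Fintype (U n)] [∀ n, Nonempty (U n)]
        (S : ℕ → Type) [∀ n, Fintype (S n)] [∀ n, Nonempty (S n)]
        (X : (n : ℕ) → U n → ι n → Bool) (P : (n : ℕ) → S n → ι n → Bool),
        ∃ a : ℕ, ∀ s : ℕ → ℕ,
          (∃ C : (n : ℕ) → Circuit (ι n),
            (∀ᶠ n : ℕ in atTop, (C n).IsOver B2 ∧ (C n).size ≤ s n) ∧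
            Tendsto (fun n : ℕ =>
              ((PMF.uniformOfFintype (U n × S n)).map fun p => X n p.1).toOuterMeasure
                  {x | (C n).eval x = true} +
                ((PMF.uniformOfFintype (U n × S n)).map fun p => fun c => X n p.1 c || P n p.2 c).toOuterMeasure
                  {x | (C n).eval x = false}) atTop (𝓝 0)) →
          ∃ C' : (n : ℕ) → Circuit (ι n),
            (∀ᶠ n : ℕ in atTop, (C' n).IsOver monotoneBasis01 ∧
              (C' n).size ≤ (s n + Fintype.card (ι n)) ^ a) ∧
            Tendsto (fun n : ℕ =>
              ((PMF.uniformOfFintype (U n × S n)).map fun p => X n p.1).toOuterMeasure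
                  {x | (C' n).eval x = true} +
                ((PMF.uniformOfFintype (U n × S n)).map fun p => fun c => X n p.1 c || P n p.2 c).toOuterMeasure
                  {x | (C' n).eval x = false}) atTop (𝓝 0) := by
  intro h
  obtain ⟨a, ha⟩ := h (fun n => Coord n (Pos n)) (fun n => Fin n → Pos n → Bool) (fun n => Fin n → Pos n)
    (fun n u => enc u) (fun n s c => decide (c.2 = some (s c.1)))
  obtain ⟨C', hC', hT'⟩ := ha (fun n => 3 * Fintype.card (Coord n (Pos n)))
    ⟨detectCircuit, orChannel_general_detects.1, orChannel_general_detects.2⟩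
  exact orChannel_monotone_blind (fun n => (C' n).eval)
    (hC'.mono fun n hn => (C' n).monotone_eval_of_isOver_monotoneBasis01 hn.1) hT'

end Family

end Summit.PneNP.PneNP.Theorems.MonotoneSuffices.Negative
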